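/-
Copyright (c) 2026 the pub-hodgecm-mathlib formalisation cell (harness21).  Seat LA2-p03 (g9), line «L2», DEFAULT task after the LEAD's word
«M-152» (SEQUEL: pay the two theta rows of the registry `Lines/d6_cm_curve` BY TERM modulo the ONE printed letter #184♮), 2026-09-03.
★ file F3 of the chain «HLiu418 OF #184♮»: the F0 socket's junctions `Cruxes/HLiu418/Lines/F0_AlbCm.lean` (ED. 13) :361–:392 Theorems-homed with the
two printed theta letters #73 ∕ #74R as BINDERS.  No `def`, no `sorry`, axioms TRIO.
-/
import Summits.HodgeConjecture.HodgeConjecture.Theorems.F0D6CmCurveBody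
import Summits.HodgeConjecture.HodgeConjecture.Theorems.F0D9opRoad2
import Summits.HodgeConjecture.CorCM.HypLiu418.A3Liu418GSRosH
import Summits.HodgeConjecture.CorCM.HypLiu418.A3Liu418GSInstance
import Literature.AlgebraicGeometry.Motives.JacobianGaloisCoverNormAdjointHolds
import Literature.AlgebraicGeometry.Motives.JacobianRiemannThetaDivisorHolds
import Literature.NumberTheory.Automorphic.Liu2021.AppendixC.OmegaHomBettiComparisonRank
import Literature.NumberTheory.Automorphic.Liu2021.AppendixC.BettiComparisonOfPinning
import Literature.NumberTheory.Automorphic.Liu2021.AppendixC.H1ComparisonFamilyHolds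
import Summits.HodgeConjecture.HodgeConjecture.Theorems.F0P5StubS1bTransfer
import Summits.HodgeConjecture.HodgeConjecture.Theorems.F0AlbCmStubS1Pinning
import Summits.HodgeConjecture.HodgeConjecture.Theorems.F0AlbCmS1BettiHolds
import Summits.HodgeConjecture.HodgeConjecture.Theorems.F0AlbCmS1bHodgeHoldsNecPos
import Summits.HodgeConjecture.HodgeConjecture.Theorems.F0AlbCmS1BettiHoldsSignedThetaNecPos
import Summits.HodgeConjecture.HodgeConjecture.Theorems.HLiu418E3NecessityPos
import Summits.HodgeConjecture.HodgeConjecture.Theorems.F0P5TP2Holds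
import Summits.HodgeConjecture.HodgeConjecture.Theorems.HLiu418E2LevelFinite
import HarnessLib

/-!
# Crux `HLiu418` — the two THETA ROWS `S1Shape` ∕ `S1bShape` of the registry `Lines/d6_cm_curve` and [Liu2021, Thm. D.6 (1)] for the one curve,
# `thmD6OneCurveCUF`, FROM the two printed theta letters #73 `curveThetaCohFinComponentUnique_hol` and #74R `curveThetaHodgeTypeNecessity_hol_pos` (★)

`Summits/HodgeConjecture/HodgeConjecture/Theorems/F0AlbCmThetaRowsOfFacts.lean`; namespace
`Summit.HodgeConjecture.HodgeConjecture.Cruxes.HLiu418.F0AlbCmThetaRowsOfFacts`.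

WHAT.  The F0 socket `Cruxes/HLiu418/Lines/F0_AlbCm.lean` (EDITION 13, sorry-free in file) pays the registered theta rows of the d6 registry,
`S1Shape` ([Liu2021, Prop. D.4 (1)] clause (1), «multiplicity at most one» at `ω⋆_lab`) and `S1bShape` (clause (2) ∕ [Rem. D.5], the Hodge-type ∕
orientation sentence on the CM quotient), and [Liu2021, Thm. D.6 (1)] for the one curve `thmD6OneCurveCUF`, from two PACKAGED named facts
`stub_S1_facts : Rogawski1990.curveThetaCohFinComponentUnique_hol` (#73) and `stub_S1b_facts : Rogawski1990.curveThetaHodgeTypeNecessity_hol_pos` (#74R), every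
other input being a ★ theorem.  THIS FILE is that payment with the two letters as HYPOTHESES, Theorems-homed (so that a `Lines` registry and ★ closers may
import it):

* `s1Shape_of_facts (h73) (h74R) : S1Shape` — junction J0 of `F0_AlbCm` (`s1Shape_of_betti`, the ℓ-adic letter from the Betti multiplicity bound and a Betti
  pinning, [SGA4 XI 4.4] ★ `exists_h1ComparisonFamily_holds`, ★ `BettiPinning.exists_bettiComparison`, ★ `BettiComparison.mult1Line_of_rank_le_one`) fed with
  ★ `F0AlbCmS1BettiHoldsSignedThetaNecPos.stub_S1_betti_holds_theta_nec_pos_of_hol_pos h73 h74R TPhol E₂hol` and ★ `F0AlbCmStubS1Pinning.stub_S1_pinning_holds`;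
* `s1bShape_of_fact (h74R) : S1bShape` — ★ `F0P5StubS1bTransfer.stubS1bTransfer_holds` ∘ (★ pinning, ★ `F0AlbCmS1bHodgeHoldsNecPos.stub_S1b_hodge_holds_nec_pos_of_hol_pos
  h74R TPhol`);
* `rosH_holds : RosHShape` — as in the registry (★ `socketRosH_GS_of_FR_FP2` with both §8.2 Jacobian rows by their ★ closers);
* `thmD6_of_facts (h73) (h74R) : thmD6OneCurveCUF` — ★ `thmD6OneCurveCUF_of_D9Mop` with `S2primeShape` by ★ `s2primeShape_of_RosH_S1 rosH_holds _` and the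
  Eichler–Shimura operator relation [Liu2021, Cor. D.9] by the ★ parent head `F0D9opRoad2.stub_D9op_holds` (K6 re-home, p853642).

With F1 ★ `F0P6LD1StubS1FactsOfA2P.curveThetaCohFinComponentUnique_hol_of_A₂P : #184♮ → #73` and F2 (`#184♮ → #74R`, LA2-p02 (g7)) the registry pays
`stub_S1 := s1Shape_of_facts (F1 stub_A₂P) (F2 stub_A₂P)`, `stub_S1b := s1bShape_of_fact (F2 stub_A₂P)` from ONE registered letter stub (LEAD «M-152» SEQUEL).

HONEST SCOPE.  CONDITIONAL on the two printed theta letters (binders, visible in every type); nothing printed is discharged.  HC_CM is proved only modulo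
the 7 printed citations (2 remaining: hLiu418 = stmt-HodgeConjecture-24832, h413 = stmt-HodgeConjecture-24833) until rung 0 closes; count-neutral.

## References
* [Liu2021] Y. Liu, *Fourier–Jacobi cycles and arithmetic relative trace formula*, Camb. J. Math. 9 (2021): §4.2 (FJcycle.tex l. 2074–2081, 2152–2168);
  App. D Prop. D.4 (1), Rem. D.5 (p. 130–131), Thm. D.6 (1) (p. 132) and its proof (p. 139–140), Cor. D.9 (p. 138).
* [SGA4Tome3] M. Artin, A. Grothendieck, J.-L. Verdier, SGA 4 Tome 3, Exp. XI Thm. 4.4 (étale ∕ Betti comparison).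
* [Rogawski1990] J. Rogawski, Ann. of Math. Stud. 123 (1990), §11 (context of the two letters).
* [MumfordAV1970] D. Mumford, *Abelian varieties*, §21 Thm. 1; [LangeRodriguez2022] §3.2.1 Prop. 3.2.1 (Rosati positivity inputs of `rosH_holds`).
-/

noncomputable section

namespace Summit.HodgeConjecture.HodgeConjecture.Cruxes.HLiu418.F0AlbCmThetaRowsOfFacts

set_option linter.dupNamespace false  -- `Summit.HodgeConjecture.HodgeConjecture.…` BY DESIGN (D-0017)

open scoped TensorProduct Matrix NumberField Kronecker ComplexOrder
open NumberField NumberField.InfinitePlace IsDedekindDomain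
open CategoryTheory
open Summit.HodgeConjecture.CorCM.Model Summit.HodgeConjecture.CorCM.Model.HComp Summit.HodgeConjecture.CorCM.HComp
open Literature.AlgebraicGeometry.Motives (CMType AbelianVariety)
open Literature.AlgebraicGeometry.ShimuraVarieties.UnitaryCanonicalModel
open Literature.NumberTheory.Automorphic Literature.NumberTheory.Automorphic.UnitaryGroup
open Literature.NumberTheory.Automorphic.IdeleClassGroup Literature.NumberTheory.Automorphic.Liu2021 Literature.NumberTheory.Automorphic.Liu2021.AppendixC
open Literature.NumberTheory.GaloisRepresentations Literature.RepresentationTheory.Liu2021 Literature.RepresentationTheory.HarrisKudlaSweet1996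
open Literature.AlgebraicGeometry.Liu2021 (IsAdmissibleElement)
open Literature.NumberTheory.Weil1964 Literature.NumberTheory.GelbartRogawski1991 Literature.NumberTheory.GelbartRogawski1991.UnitaryDualPair Literature.NumberTheory.GelbartRogawski1991.UnitaryDualPair.WeilCoinv
open Literature.NumberTheory.GelbartRogawski1991.UnitaryDualPair.LocalSplitting
open Literature.NumberTheory.Automorphic.Liu2021.Def411WeilCarriersDoubling
open Literature.NumberTheory.Automorphic.Liu2021.Def411WeilCarriers (TW JW JW_eq isSymm_TW isUnit_det_TW Rep Eps epsOf Chi rhoVAtLine)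
open Summit.HodgeConjecture.CorCM (CMField)
open Summit.HodgeConjecture.CorCM.Lines.A3Liu418
open Summit.HodgeConjecture.CorCM.HypLiu418


set_option maxHeartbeats 400000 in  -- instance-path defeq between the Body's elaboration of `ω⋆_lab` (in `S1Shape`) and `F0AlbCmS1BettiHolds.S1BettiShape`; > 200 k, measured in `F0_AlbCm` J0
/-- **`S1Shape` ([Liu2021, Prop. D.4 (1)] clause (1): multiplicity at most one at the registered `ω⋆_lab`) FROM the two printed theta letters #73 ∕ #74R.**
Junction J0 of the F0 socket: the ℓ-adic letter from the Betti multiplicity bound ★ `F0AlbCmS1BettiHoldsSignedThetaNecPos.stub_S1_betti_holds_theta_nec_pos_of_hol_pos`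
(signed θ-fold: S1-R realisation + the `n = 2` slice with the signed exclusion on the necessity letters + (L10)∕(L01), fed E1θhol = `h73`, E3nec-hol = `h74R`,
antihol by ★ conjugation, TPhol ★ `F0P5TP2Holds`, E₂hol ★ `E2LevelFinite`) and the Betti pinning ★ `F0AlbCmStubS1Pinning.stub_S1_pinning_holds`, transported
to `ℚ̄_ℓ ⊗ H¹_ét` by ★ `exists_h1ComparisonFamily_holds` [SGA4 XI 4.4], ★ `BettiPinning.exists_bettiComparison`, ★ `isInducedBy_etaleHeckeDatumGS` and ★
`BettiComparison.mult1Line_of_rank_le_one` — the body of `F0_AlbCm.s1Shape_of_betti` token for token.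
[cite: Liu2021, Prop. D.4 (1) p. 130–131; §4.2 (FJcycle.tex l. 2152–2168)] [cite: SGA4Tome3, Exp. XI Thm. 4.4] -/
theorem s1Shape_of_facts (h73 : Literature.NumberTheory.Rogawski1990.curveThetaCohFinComponentUnique_hol)
    (h74R : Literature.NumberTheory.Rogawski1990.curveThetaHodgeTypeNecessity_hol_pos) : S1Shape := by
  have hB := F0AlbCmS1BettiHoldsSignedThetaNecPos.stub_S1_betti_holds_theta_nec_pos_of_hol_pos h73 h74R
    F0P5TP2Holds.holCotFormSpectralProjection₂_holds E2LevelFinite.cohIsotypicLine₂_hol_holds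
  have hP := F0AlbCmStubS1Pinning.stub_S1_pinning_holds
  intro F _ ι₁ μ hμ hw ℓ _ ι' Jstar t ht hτt hτt' gstar dJ hdJ hdJ0 hg hsig K₀ S hU7ₛ hLQ h4 isoₛ r ε hadm χ f hfω g hgω
  obtain ⟨H, _, _, rhoB, ⟨B⟩⟩ := hP F ι₁ Jstar K₀ S hU7ₛ h4 isoₛ
  obtain ⟨c⟩ := exists_h1ComparisonFamily_holds (E := (F : Type)) (ι₁ : (F : Type) →+* ℂ) ℓ ι'
  obtain ⟨cmp, -⟩ := B.exists_bettiComparison c (etaleHeckeDatumGS S hU7ₛ hLQ h4 isoₛ ℓ) (isInducedBy_etaleHeckeDatumGS S hU7ₛ hLQ h4 isoₛ ℓ)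
  have hrk := hB F ι₁ μ hμ hw Jstar t ht hτt hτt' gstar dJ hdJ hdJ0 hg hsig K₀ S hU7ₛ h4 isoₛ r ε hadm χ H rhoB B
  by_cases hf0 : f = 0
  · exact ⟨0, Or.inr (hf0.trans (zero_smul _ g).symm)⟩
  · have key := cmp.mult1Line_of_rank_le_one _ hrk
    obtain ⟨b, hb⟩ := key f hfω g hgω hf0
    exact ⟨b, Or.inl hb⟩

/-- **`S1bShape` (the d6 letter: [Liu2021, Prop. D.4 (1) clause (2) ∕ Rem. D.5], the ℓ-adic `τ`-eigen class of Hodge type `(1,0)` iff `ι₁ ∈ Φ_μ` on a CM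
quotient `B′` of `A_K`) FROM the printed oriented necessity letter #74R** — the S1b cut of the F0 socket: TRANSFER ★ `F0P5StubS1bTransfer.stubS1bTransfer_holds`
of the Betti pinning ★ `F0AlbCmStubS1Pinning.stub_S1_pinning_holds` and the Hodge statement on the tower's own levels ★
`F0AlbCmS1bHodgeHoldsNecPos.stub_S1b_hodge_holds_nec_pos_of_hol_pos h74R TPhol` (sign table [Rem. D.5], isotypic Hodge split of a pinned Betti tower,
Hodge-typed realisation, signed exclusion; antihol by ★ conjugation, TPhol ★ `F0P5TP2Holds`).
[cite: Liu2021, Rem. D.5 p. 131; Lem. D.2 (3) p. 128; proof of Thm. D.6 (1) p. 140; §4.2 (FJcycle.tex l. 2152–2168)] [cite: SGA4Tome3, Exp. XI Thm. 4.4] -/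
theorem s1bShape_of_fact (h74R : Literature.NumberTheory.Rogawski1990.curveThetaHodgeTypeNecessity_hol_pos) : S1bShape :=
  F0P5StubS1bTransfer.stubS1bTransfer_holds F0AlbCmStubS1Pinning.stub_S1_pinning_holds
    (F0AlbCmS1bHodgeHoldsNecPos.stub_S1b_hodge_holds_nec_pos_of_hol_pos h74R F0P5TP2Holds.holCotFormSpectralProjection₂_holds)

/-- **`RosHShape` IS A THEOREM** (as in the registry `d6_cm_curve` vB8 and the socket `F0_AlbCm`, re-derived here because neither `Lines` tail is an importable
★ module): ★ `socketRosH_GS_of_FR_FP2` (p765203) with both §8.2 Jacobian rows by their ★ closers `…_holds` (VI-7 Riemann theta divisor, VI-8 Galois-cover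
norm adjointness). [cite: MumfordAV1970, §21 Thm. 1 p. 208] [cite: LangeRodriguez2022, §3.2.1 Prop. 3.2.1 p. 55] [cite: Liu2021, App. D §D.4 p. 140] -/
theorem rosH_holds : RosHShape :=
  fun _F _ _ι₁ _μ _hμ _hw _ℓ _ _ι' _Jstar _t _ht _hτt _hτt' _gstar _dJ _hdJ _hdJ0 _hg _hsig _K₀ S hU7ₛ hLQ h4 isoₛ _r _ε _hadm _χ =>
    socketRosH_GS_of_FR_FP2 S hU7ₛ hLQ h4 isoₛ
      Literature.AlgebraicGeometry.Motives.Jacobian.riemann_brillNoetherLocus_isPrincipalPolarizationDivisor_holds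
      Literature.AlgebraicGeometry.Motives.Jacobian.galoisCover_pullback_isWeilPairingAdjoint_norm_holds

/-- **[Liu2021, Thm. D.6 (1)] for the one curve, `thmD6OneCurveCUF`, FROM the two printed theta letters #73 ∕ #74R** — ★ `thmD6OneCurveCUF_of_D9Mop` with
`S1Shape` ∕ `S1bShape` from the letters (above), `S2primeShape` by ★ `s2primeShape_of_RosH_S1 rosH_holds _` (σ-free road (P); the S1 letter consumed a second
time as the multiplicity-one input) and the Eichler–Shimura operator relation [Liu2021, Cor. D.9] for `M⋆` by the ★ parent head `F0D9opRoad2.stub_D9op_holds`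
(derived in-house along the K6 chain ★ `Theorems/F0D9opRoad2*` ∕ `Theorems/F0P6a*`).
[cite: Liu2021, Thm. D.6 (1) p. 132 and its proof p. 139–140; Cor. D.9 p. 138; Prop. D.8 p. 135] -/
theorem thmD6_of_facts (h73 : Literature.NumberTheory.Rogawski1990.curveThetaCohFinComponentUnique_hol)
    (h74R : Literature.NumberTheory.Rogawski1990.curveThetaHodgeTypeNecessity_hol_pos) : thmD6OneCurveCUF :=
  thmD6OneCurveCUF_of_D9Mop (s1Shape_of_facts h73 h74R) (s1bShape_of_fact h74R)
    (s2primeShape_of_RosH_S1 rosH_holds (s1Shape_of_facts h73 h74R)) F0D9opRoad2.stub_D9op_holds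

end Summit.HodgeConjecture.HodgeConjecture.Cruxes.HLiu418.F0AlbCmThetaRowsOfFacts

end
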